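import Literature.AlgebraicGeometry.AbelianSchemes.MumfordQuotientPoincare
import Literature.AlgebraicGeometry.AbelianSchemes.MumfordBundleSchemeLinearisation  -- ★ ED. 2: Dβ-thm (C) «LH6» LH6-p01 (g8)
import Literature.AlgebraicGeometry.AbelianSchemes.AbelianSchemeKOfLClosedSubscheme   -- ★ ED. 2: `K(L) ↪ A`
import Literature.AlgebraicGeometry.AbelianSchemes.AbelianSchemeOverHomNoetherianAnyBase -- ★ ED. 2: `IsCommMonObj A.X`
import Literature.AlgebraicGeometry.RelativeSpec.TorsorQuotientLinearisationDescent  -- ★ ED. 2: the junction's generic half (this hand)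
import Literature.AlgebraicGeometry.GroupSchemes.TorsorSquareOfKernel               -- ★ ED. 2: Dα + ED. 2 term «LH6» LH6-p03 (g13)
import Literature.AlgebraicGeometry.GroupSchemes.TorsorQuotientKernelOnPoints        -- ★ ED. 2: `GrpObj Z` from the factorisation clauses
import HarnessLib

/-!
# Mumford's Poincaré module on `A × Â` for `Â = A⁄K(L)`, `K(L)` a finite FLAT subgroup scheme — §1: rigidifying ANY descent
# of `Λ(L)` along `1 × q` ([MumfordAV1970] §13, proof of the Theorem pp. 125–127; [MumfordFogartyKirwan1994] Ch. 6 §2 p. 121)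

Layer `Literature/AlgebraicGeometry/AbelianSchemes`, namespace `Literature.AlgebraicGeometry.AbelianSchemes.AbelianSchemeOver`.
THEOREMS ONLY (no definition, no named fact, no instance, no notation, no `sorry`).

[MumfordAV1970] §13, Theorem p. 125 and its proof: for `π : A → Â = A⁄K(L)` the Poincaré sheaf `𝒫` on `A × Â` is the DESCENT of
Mumford's bundle `Λ(L) = m^*L ⊗ p₁^*L⁻¹ ⊗ p₂^*L⁻¹` along `1 × π`, normalised along `{0} × Â`; its slices `𝒫|_{A × {π a}} ≅ t_a^*L ⊗ L⁻¹`
lie in `Pic⁰` (§8 p. 77).  The ★ constant-group road `MumfordQuotientPoincare` §2 `exists_rigidified_descent_mumfordBundle_of_quotient`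
does this for a free quotient by a finite GROUP, in two moves: (a) descend `Λ(L)` along `1 × q` by finite-group descent (★ (β)∕(T1)), (b)
RIGIDIFY the descended rank-one module along `ε_A × 1` and read its slices through the surjection `q` from `Λ(L)` itself (★ `rigidify`, ★
`exists_rigidifiedLineBundle_mumfordBundle_fibrewisePicZero`, ★ `RigidifiedLineBundle.forall_isHomogeneous_fibreSlice_of_rigidified_of_surjective`, ★
`nonempty_pullback_whiskerLeft_rigidify_iso`).  Move (b) uses NO group: THIS FILE isolates it —

* §1 **`exists_rigidified_poincare_of_descent_mumfordBundle`** — for abelian schemes `A`, `B` over ANY base `S`, an `S`-morphism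
  `q : A → B` surjective and locally of finite type, `L` of rank one on `A` rigidified along the unit section, and ANY rank-one module `F` on
  `A ×_S B` with `(1 × q)^*F ≅ Λ(L)`: there is `𝒫` on `A ×_S B` with (F1) `HasRank 𝒫 1`, (F2) `(ε_A × 1_B)^*𝒫 ≅ 𝒪_B`, (F3) every geometric
  slice `𝒫|_{A_s × {b}}` translation invariant (`∈ Pic⁰`), (F4) `(1 × q)^*𝒫 ≅ Λ(L)` — namely `𝒫 := A.rigidify B F`;
  `exists_poincare_of_descent_mumfordBundle` — the same without (F2), the shape of the wave-C socket §D.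

so that move (a) may be supplied by ANY descent engine: the finite-group one (★, recovering ★ §2), or the finite FLAT group-scheme one of
the wave-C line of cell `hodgecm-mathlib` (D-0151) for §D `F0P6bMumfordDualFlat.stub_L4B1uD_mumfordLambdaDescent` of
`Cruxes/HLiu418/Lines/F0_P6b_MumfordDualFlat.lean` (Dα torsor square ★ `GroupSchemes/TorsorSquareOfKernel`, Dβ linearisation ★
`Modules/SchemeLinearisation` + `AbelianSchemes/MumfordBundleSchemeLinearisation`, Dγ descent ★ `RelativeSpec/SchemeEquivariantModuleInvariants` +
`TorsorQuotientModuleChart*` + `TorsorQuotientModuleDescent`) — whose junction (Dδ, F0P3a-p09 (g26)) is §2 of this file, appended when those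
organs are ★.  Count-neutral (`--supports stmt-HodgeConjecture-24832`); HC_CM is proved only modulo the printed citations (2 remaining named inputs
hLiu418 = `stmt-HodgeConjecture-24832`, h413 = `stmt-HodgeConjecture-24833`) until rung 0 closes; nothing here is about HC.

EDITION 2 (append-only; §1 byte-identical): §2 **`exists_descent_mumfordBundle_of_finiteFlatKernel`** — THE D-CORE: over `Spec R`, `R`
Noetherian, for `π : A → Â` a finite flat surjective homomorphism of abelian schemes whose kernel on `T`-points is `K(L)` (`L` rank one,
rigidified), `Λ(L)` DESCENDS along `1 × π` to a rank-one module — the junction of the wave-C organs BY NAME: `K(L) ↪ A` closed subgroup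
scheme (★ `exists_isClosedImmersion_subgroup_iff_memKOfL_of_isNoetherianRing`, ★ `TorsorQuotientKernel.Over.exists_grpObj_isMonHom_of_factors`),
the kernel translation `ModObj.ofKernelTranslation` on the second factor and its TORSOR SQUARE (★ Dα `TorsorSquareOfKernel`), the normalised
`K(L)`-LINEARISATION of `Λ(L)` (★ Dβ `MumfordBundleSchemeLinearisation.nonempty_linearisation_mumfordBundle`), and DESCENT OF A LINEARISED LINE
BUNDLE ALONG A TORSOR QUOTIENT (★ `TorsorQuotientLinearisationDescent.exists_descent_of_linearisation`, over ★ (i) (ii) (iii) (E4) s19);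
§3 **`exists_poincare_of_finiteFlatKernel`** — §2 + §1 over an algebraically closed field: the conclusion of the wave-C socket §D
`F0P6bMumfordDualFlat.stub_L4B1uD_mumfordLambdaDescent` TOKEN FOR TOKEN (its №1 ED. 4 body is `fun … => exists_poincare_of_finiteFlatKernel …`).

Mathlib searched (pin): `Scheme.Modules.pullback`, `IsFinite`/`Surjective`/`LocallyOfFiniteType` instances; Mathlib has no abelian schemes,
no Mumford bundle, no rigidification.  Tree: everything used is ★ (`MumfordQuotientPoincare` §1, `RigidifyAlongUnitSlice`,
`FibrewisePicZeroDescendsAlongSurjection`); nothing restated.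

## References
* [MumfordAV1970] D. Mumford, *Abelian Varieties* (1970), §13 (Thm. p. 125 and its proof pp. 125–127), §8 (p. 77), §12 Thm. 1 (p. 112).
* [MumfordFogartyKirwan1994] D. Mumford, J. Fogarty, F. Kirwan, *GIT* 3rd ed. (1994), Ch. 6 §2 (p. 121) (normalisation along `ε × 1`).
* [MilneAV2008] J. S. Milne, *Abelian Varieties* (v2.00, 2008), I §8 pp. 36–37.
-/

set_option autoImplicit false

noncomputable section

-- `Scheme.Modules` / `SheafOfModules` are not reducible; `(A.X ⊗ B.X).left = A.prodLeft B` holds by `rfl` only (as in ★ `MumfordQuotientPoincare`).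
set_option backward.isDefEq.respectTransparency false

universe u

open CategoryTheory CategoryTheory.Limits AlgebraicGeometry MonoidalCategory
open scoped MonObj

namespace Literature.AlgebraicGeometry.AbelianSchemes

open Literature.AlgebraicGeometry.Modules Literature.AlgebraicGeometry.Motives Literature.AlgebraicGeometry.AbelianVarieties

namespace AbelianSchemeOver

variable {S : Scheme.{u}} (A : AbelianSchemeOver S) {L : A.left.Modules} (hL : HasRank L 1)
  (hε : CechPic.pullback A.unitSection (detClass (HasRank.isFiniteLocallyFree' hL)) = 1)

/-! ## §1 Rigidifying ANY descent of `Λ(L)` along `1 × q` -/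

include hL hε in
/-- **MUMFORD'S POINCARÉ MODULE FROM ANY DESCENT OF `Λ(L)` ALONG `1 × q`** ([MumfordAV1970] §13, proof of the Theorem; the group-free
half of ★ `exists_rigidified_descent_mumfordBundle_of_quotient`).  Let `A`, `B` be abelian schemes over `S`, `q : A → B` an `S`-morphism,
surjective and locally of finite type, `L` of rank one on `A` rigidified along the unit section, and `F` ANY rank-one module on `A ×_S B` with
`(1 × q)^*F ≅ Λ(L)`.  Then `𝒫 := rigidify F` satisfies (F1) `HasRank 𝒫 1` (★ `hasRank_rigidify`), (F2) `(ε_A × 1_B)^*𝒫 ≅ 𝒪_B` (★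
`nonempty_pullback_unitSlice_rigidify_iso`), (F3) every geometric slice `𝒫|_{A_s × {b}}` is translation invariant — `Λ(L)` is itself a
rigidified fibrewise-`Pic⁰` family over the second factor (★ `exists_rigidifiedLineBundle_mumfordBundle_fibrewisePicZero`) and slices are read
through the surjection `q` (★ `RigidifiedLineBundle.forall_isHomogeneous_fibreSlice_of_rigidified_of_surjective`, ★ `isHomogeneous_fibreSlice_rigidify_iff`)
— and (F4) `(1 × q)^*𝒫 ≅ Λ(L)` (★ `nonempty_pullback_whiskerLeft_rigidify_iso`).
[cite: MumfordAV1970, §13 Theorem (p. 125) and its proof] [cite: MumfordFogartyKirwan1994, Ch. 6 §2 (p. 121)] [cite: MilneAV2008, I §8 pp. 36–37] -/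
theorem exists_rigidified_poincare_of_descent_mumfordBundle (B : AbelianSchemeOver S) (q : A.X ⟶ B.X)
    [Surjective q.left] [LocallyOfFiniteType q.left] (F : (A.prodLeft B).Modules) (hF : HasRank F 1)
    (e : Nonempty ((Scheme.Modules.pullback (A.X ◁ q).left).obj F ≅ A.mumfordBundle L)) :
    ∃ P : (A.prodLeft B).Modules, HasRank P 1 ∧
      Nonempty ((Scheme.Modules.pullback (A.unitSlice B)).obj P ≅ SheafOfModules.unit _) ∧
      (∀ (Ω : Type u) [Field Ω] [IsAlgClosed Ω] (b : Spec (.of Ω) ⟶ B.X.left),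
        IsHomogeneous (A.fibre (b ≫ B.X.hom)).toAbelianVariety ((Scheme.Modules.pullback (A.fibreSlice B b)).obj P)) ∧
      Nonempty ((Scheme.Modules.pullback (A.X ◁ q).left).obj P ≅ A.mumfordBundle L) := by
  obtain ⟨𝒬, h𝒬L, h𝒬⟩ := A.exists_rigidifiedLineBundle_mumfordBundle_fibrewisePicZero hL hε
  have e𝒬 : Nonempty ((Scheme.Modules.pullback (A.X ◁ q).left).obj F ≅ 𝒬.L) := ⟨e.some ≪≫ eqToIso h𝒬L.symm⟩
  refine ⟨A.rigidify B F, hasRank_rigidify hF, nonempty_pullback_unitSlice_rigidify_iso hF, fun Ω _ _ b => ?_, ?_⟩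
  · rw [isHomogeneous_fibreSlice_rigidify_iff hF]
    exact RigidifiedLineBundle.forall_isHomogeneous_fibreSlice_of_rigidified_of_surjective A 𝒬 B q F h𝒬 e𝒬 Ω b
  · obtain ⟨i⟩ := nonempty_pullback_whiskerLeft_rigidify_iso (B := B) hF q 𝒬 e𝒬
    exact ⟨i ≪≫ eqToIso h𝒬L⟩

include hL hε in
/-- **The wave-C socket shape** (§D `stub_L4B1uD_mumfordLambdaDescent` asks exactly this at `S = Spec K`, `q = π` finite flat surjective with
kernel `K(L)`): from ANY rank-one descent `F` of `Λ(L)` along `1 × q` (`q` surjective, locally of finite type), a rank-one `𝒫` on `A ×_S B` with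
every geometric slice in `Pic⁰` and `(1 × q)^*𝒫 ≅ Λ(L)` (`exists_rigidified_poincare_of_descent_mumfordBundle` with (F2) dropped).
[cite: MumfordAV1970, §13 Theorem (p. 125) and its proof; §8 (p. 77)] [cite: MilneAV2008, I §8 pp. 36–37] -/
theorem exists_poincare_of_descent_mumfordBundle (B : AbelianSchemeOver S) (q : A.X ⟶ B.X)
    [Surjective q.left] [LocallyOfFiniteType q.left] (F : (A.prodLeft B).Modules) (hF : HasRank F 1)
    (e : Nonempty ((Scheme.Modules.pullback (A.X ◁ q).left).obj F ≅ A.mumfordBundle L)) :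
    ∃ (P : (A.prodLeft B).Modules) (_ : HasRank P 1),
      (∀ (Ω : Type u) [Field Ω] [IsAlgClosed Ω] (b : Spec (.of Ω) ⟶ B.X.left),
        IsHomogeneous (A.fibre (b ≫ B.X.hom)).toAbelianVariety ((Scheme.Modules.pullback (A.fibreSlice B b)).obj P)) ∧
      Nonempty ((Scheme.Modules.pullback (A.X ◁ q).left).obj P ≅ A.mumfordBundle L) := by
  obtain ⟨P, hP, -, hpic, hsock⟩ := A.exists_rigidified_poincare_of_descent_mumfordBundle hL hε B q F hF e
  exact ⟨P, hP, hpic, hsock⟩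

/-! ## §2 (ED. 2) The D-CORE: `Λ(L)` descends along `1 × π` for `π` with finite flat kernel `K(L)` -/

open CartesianMonoidalCategory Literature.AlgebraicGeometry.GroupSchemes Literature.AlgebraicGeometry.RelativeSpec in
/-- **`Λ(L)` DESCENDS ALONG `1 × π : A × A → A × Â` TO A RANK-ONE MODULE, for `π` finite flat surjective with kernel `K(L)`**
([MumfordAV1970] §13, proof of the Theorem pp. 125–127: «`X̂ = X⁄K(L)`; `K(L)` acting on the second factor of `X × X` lifts to `Λ(L)`;
descend by §12 Thm. 1»).  Over `Spec R`, `R` Noetherian: `A`, `Â` abelian schemes, `π : A → Â` a homomorphism, finite, flat and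
surjective on underlying schemes, whose kernel on all `T`-valued points is `K(L)` (`hK`) for `L` of rank one rigidified along the unit
section.  Then there is `P₀` of rank one on `A ×_R Â` with `(1 × π)^*P₀ ≅ Λ(L)`.  Junction of ★ organs by name: `K(L) ↪ A` is a closed
subgroup scheme `i : Z ↪ A` (★ `exists_isClosedImmersion_subgroup_iff_memKOfL_of_isNoetherianRing`, ★ `Over.exists_grpObj_isMonHom_of_factors`);
`Z` translating the second factor (★ `ModObj.ofKernelTranslation`) makes `1 × π` a TORSOR (★ `Over.isPullback_smul_snd_of_kernel`); `Λ(L)`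
carries a `Z`-LINEARISATION (★ `nonempty_linearisation_mumfordBundle`, `i ∈ K(L)(Z)`); a linearised line bundle DESCENDS along a torsor
quotient (★ `TorsorQuotient.exists_descent_of_linearisation`). [cite: MumfordAV1970, §13 Theorem (p. 125) and its proof]
[cite: MumfordAV1970, §12 Thm. 1 (p. 112)] -/
theorem exists_descent_mumfordBundle_of_finiteFlatKernel {R : Type} [CommRing R] [IsNoetherianRing R]
    (A hat : AbelianSchemeOver (Spec (.of R))) (π : A.X ⟶ hat.X) [IsMonHom π] [IsFinite π.left] [Flat π.left]
    [Surjective π.left] {L : A.left.Modules} (hL : HasRank L 1)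
    (hε : CechPic.pullback A.unitSection (detClass (HasRank.isFiniteLocallyFree' hL)) = 1)
    (hK : ∀ (T : Over (Spec (.of R))) (u : T ⟶ A.X), u ≫ π = 1 ↔ A.MemKOfL L u) :
    ∃ P₀ : (A.prodLeft hat).Modules, HasRank P₀ 1 ∧
      Nonempty ((Scheme.Modules.pullback (A.X ◁ π).left).obj P₀ ≅ A.mumfordBundle L) := by
  -- `K(L) ↪ A`: closed, with the points clause, stable under unit ∕ product ∕ inverse (Noetherian affine base)
  obtain ⟨Z, i, hci, hZ, he, hm, hn⟩ := A.exists_isClosedImmersion_subgroup_iff_memKOfL_of_isNoetherianRing hL hε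
  haveI : IsClosedImmersion i.left := hci
  -- hence a closed subGROUP scheme
  obtain ⟨instZ, hmon⟩ := TorsorQuotientKernel.Over.exists_grpObj_isMonHom_of_factors i he hm hn
  letI : GrpObj Z := instZ
  haveI : IsMonHom i := hmon
  -- the kernel clause through `Z`, and `i ∈ K(L)(Z)`
  have hker : ∀ (T : Over (Spec (.of R))) (u : T ⟶ A.X), u ≫ π = 1 ↔ ∃ v : T ⟶ Z, v ≫ i = u :=
    fun T u => (hK T u).trans (hZ T u).symm
  have hiK : A.MemKOfL L i := (hZ Z i).1 ⟨𝟙 Z, Category.id_comp i⟩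
  -- `Z = K(L)` translating the SECOND factor of `A × A`; `1 × π` is a torsor for it (★ Dα)
  letI : ModObj Z (A.X ⊗ A.X) := TorsorSquareOfKernel.ModObj.ofKernelTranslation i A.X
  have hsqO : IsPullback γ[Z, A.X ⊗ A.X] (snd Z (A.X ⊗ A.X)) (A.X ◁ π) (A.X ◁ π) :=
    TorsorSquareOfKernel.Over.isPullback_smul_snd_of_kernel i π hker A.X
  have hw : γ[Z, A.X ⊗ A.X] ≫ (A.X ◁ π) = snd Z (A.X ⊗ A.X) ≫ (A.X ◁ π) := hsqO.w
  have hsq : IsPullback (γ[Z, A.X ⊗ A.X]).left (snd Z (A.X ⊗ A.X)).left (A.X ◁ π).left (A.X ◁ π).left :=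
    hsqO.map (Over.forget _)
  -- `1 × π` is finite (hence affine), flat, surjective
  haveI : IsFinite (A.X ◁ π).left := TorsorSquareOfKernel.Over.isFinite_whiskerLeft_left π A.X
  haveI : Flat (A.X ◁ π).left := TorsorSquareOfKernel.Over.flat_whiskerLeft_left π A.X
  haveI : Surjective (A.X ◁ π).left := TorsorSquareOfKernel.Over.surjective_whiskerLeft_left π A.X
  -- `K(L) → Spec R` is finite: `K(L) = π⁻¹(0)`; hence `pr₂ : K(L) × (A × A) → A × A` is affine
  have hsqZ : IsPullback i.left Z.hom π.left (η[hat.X]).left := by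
    have h := (TorsorSquareOfKernel.Over.isPullback_unit_of_kernel i π hker).map (Over.forget _)
    simpa only [Over.forget_map, Over.toUnit_left] using h
  haveI : IsFinite Z.hom := MorphismProperty.of_isPullback hsqZ ‹IsFinite π.left›
  haveI : IsAffineHom (snd Z (A.X ⊗ A.X)).left := by
    rw [Over.snd_left]; infer_instance
  -- `A` is a commutative group scheme (rigidity over the locally Noetherian base)
  haveI : IsCommMonObj A.X := A.isCommMonObj_of_isLocallyNoetherian_base
  -- the normalised `K(L)`-linearisation of `Λ(L)` (★ Dβ), then descent of a linearised line bundle along the torsor `1 × π`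
  obtain ⟨Λ⟩ := AbelianSchemeOver.nonempty_linearisation_mumfordBundle A i hL hε hiK
  exact TorsorQuotient.exists_descent_of_linearisation (A.X ◁ π) (A.mumfordBundle L) hw Λ hsq (A.hasRank_mumfordBundle hL)

/-! ## §3 (ED. 2) Mumford's Poincaré module for a finite flat kernel — the §D-shaped head -/

/-- **MUMFORD'S POINCARÉ MODULE ON `A × Â`, `Â = A⁄K(L)` BY A FINITE FLAT KERNEL** ([MumfordAV1970] §13 Theorem p. 125 and its proof;
§8 p. 77 for the slices): over an algebraically closed field `K`, for `π : A → Â` a finite flat surjective homomorphism of abelian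
schemes with kernel `K(L)` on all `T`-points, `L` of rank one rigidified along the unit section, there is a RANK-ONE `𝒫` on `A × Â` whose
slices `𝒫|_{A × {b}}` (`b ∈ Â(K)`) lie in `Pic⁰(A)` and with `(1 × π)^*𝒫 ≅ Λ(L)` — §2 rigidified by §1 (`exists_poincare_of_descent_mumfordBundle`
at `Ω := K`).  This is the conclusion of the wave-C socket §D `F0P6bMumfordDualFlat.stub_L4B1uD_mumfordLambdaDescent` token for token.
[cite: MumfordAV1970, §13 Theorem (p. 125) and its proof; §8 (p. 77)] [cite: GortzWedhorn2023, Prop. 27.176 and Prop. 27.62 (2)] -/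
theorem exists_poincare_of_finiteFlatKernel {K : Type} [Field K] [IsAlgClosed K]
    (A hat : AbelianSchemeOver (Spec (.of K))) (π : A.X ⟶ hat.X) [IsMonHom π] [IsFinite π.left] [Flat π.left]
    [Surjective π.left] {L : A.left.Modules} (hL : HasRank L 1)
    (hε : CechPic.pullback A.unitSection (detClass (HasRank.isFiniteLocallyFree' hL)) = 1)
    (hK : ∀ (T : Over (Spec (.of K))) (u : T ⟶ A.X), u ≫ π = 1 ↔ A.MemKOfL L u) :
    ∃ (P : (A.prodLeft hat).Modules) (_ : HasRank P 1),
      (∀ b : Spec (.of K) ⟶ hat.X.left,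
        IsHomogeneous (A.fibre (b ≫ hat.X.hom)).toAbelianVariety ((Scheme.Modules.pullback (A.fibreSlice hat b)).obj P)) ∧
      Nonempty ((Scheme.Modules.pullback (A.X ◁ π).left).obj P ≅ A.mumfordBundle L) := by
  obtain ⟨F, hF, e⟩ := A.exists_descent_mumfordBundle_of_finiteFlatKernel hat π hL hε hK
  obtain ⟨P, hP, hpic, hsock⟩ := A.exists_poincare_of_descent_mumfordBundle hL hε hat π F hF e
  exact ⟨P, hP, fun b => hpic K b, hsock⟩

end AbelianSchemeOver

end Literature.AlgebraicGeometry.AbelianSchemes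

end
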